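import Literature.NumberTheory.Transcendental.MultipleZetaShuffleProofs
import HarnessLib

/-!
# Multiple zeta values — Euler's sum formula in depth two, for every weight

Sibling proof file of `Literature.NumberTheory.Transcendental.MultipleZeta` (theorems only: no
definition, no statement change, no named fact), continuing `MultipleZetaDepthTwoProofs.lean`
(weight `4`) and `MultipleZetaShuffleProofs.lean` (Tornheim's double series). It proves **the sum
formula in depth two** for every weight `n ≥ 3`,

  `ζ(n-1,1) + ζ(n-2,2) + ⋯ + ζ(2,n-2) = ζ(n)`   (`multipleZeta_sum_formula_depth_two`),

in the decreasing convention of `multipleZeta` (Hoffman 1992, §3 p. 281: the case `k = 2` of the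
sum conjecture, `A(n-1,1) + A(n-2,2) + ⋯ + A(2,n-2) = ζ(n)`, "This was proved in Euler's paper";
Chmutov–Duzhin–Mostovoy 2012, (10.15), there printed in the increasing convention).

## Proof

With Tornheim's double series `W(a,b,c) = ∑_{m,n ≥ 1} m^{-a} n^{-b} (m+n)^{-c}` (written out in
product coordinates in `ℝ≥0∞` as in `MultipleZetaShuffleProofs.lean`): on the one hand the
reduction `W(q+1,1,c) = W(q,1,c+1) + ζ(c+1,q+1)` (`tsum_tornheim_succ_succ`, `tsum_tornheim_zero_right`)
unrolls to `W(n-2,1,1) = ∑_{a=2}^{n-1} ζ(a,n-a) + ζ(n-1,1)` (`tsum_tornheim_one_unroll`); on the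
other hand the telescoping `∑_n 1/(n(m+n)) = H_m/m` gives `W(p,1,1) = ∑_m H_m / m^{p+1}
= ζ(p+2) + ζ(p+1,1)` (`tsum_tornheim_one_one`; Borwein–Bradley 2006, §2, the argument of
`MultipleZetaDepthTwoProofs.lean` with a general exponent). Cancelling the finite quantity
`ζ(n-1,1)` gives the sum formula.

## References

* M. E. Hoffman, *Multiple harmonic series*, Pacific J. Math. 152 (1992), 275–290, §3 p. 281
  (sum conjecture; depth two due to Euler). [Hoffman1992]
* S. Chmutov, S. Duzhin, J. Mostovoy, *Introduction to Vassiliev Knot Invariants*, CUP (2012),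
  §10.2.6, eq. (10.15). [ChmutovDuzhinMostovoy2012]
* J. M. Borwein, D. M. Bradley, *Thirty-two Goldbach variations*, Int. J. Number Theory 2 (2006),
  65–103, §2. [BorweinBradley2006]
-/

noncomputable section

open scoped BigOperators ENNReal
open Filter _root_.Topology

namespace Literature.NumberTheory.Transcendental

/-! ### The inner telescoping sum with a general exponent -/

/-- For fixed `k` and every exponent `p`:
`∑_{m ≥ 0} 1/((k+1)^p (m+1)(m+k+2)) = H_{k+1}/(k+1)^{p+1} = (k+1)^{-(p+2)} + ∑_{j<k} 1/((j+1)(k+1)^{p+1})`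
(the telescoping `1/((m+1)(m+k+2)) = (1/(k+1)) ∑_{j ≤ k} (1/(m+j+1) - 1/(m+j+2))`;
Borwein–Bradley 2006, §2). [cite: BorweinBradley2006, §2] -/
theorem tsum_inner_telescope (p k : ℕ) :
    ∑' m : ℕ, ENNReal.ofReal (1 / (((k : ℝ) + 1) ^ p * ((m : ℝ) + 1) * ((m : ℝ) + k + 2))) =
      ENNReal.ofReal (1 / ((k : ℝ) + 1) ^ (p + 2)) +
        ∑ j ∈ Finset.range k, ENNReal.ofReal (1 / (((j : ℝ) + 1) * ((k : ℝ) + 1) ^ (p + 1))) := by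
  have hdec : ∀ m : ℕ,
      ENNReal.ofReal (1 / (((k : ℝ) + 1) ^ p * ((m : ℝ) + 1) * ((m : ℝ) + k + 2))) =
        ∑ j ∈ Finset.range (k + 1), ENNReal.ofReal (1 / ((k : ℝ) + 1) ^ (p + 1)) *
          ENNReal.ofReal (1 / (((m : ℝ) + j + 1) * ((m : ℝ) + j + 2))) := by
    intro m
    simp_rw [← ENNReal.ofReal_mul (show (0 : ℝ) ≤ 1 / ((k : ℝ) + 1) ^ (p + 1) by positivity)]
    rw [← ENNReal.ofReal_sum_of_nonneg (fun j _ => by positivity), ← Finset.mul_sum,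
      sum_range_inv_mul_succ_eq']
    congr 1
    push_cast
    rw [pow_succ]
    field_simp
    ring
  simp_rw [hdec]
  rw [Summable.tsum_finsetSum (fun _ _ => ENNReal.summable)]
  simp_rw [ENNReal.tsum_mul_left, tsum_ofReal_inv_mul_succ_eq]
  rw [Finset.sum_range_succ, add_comm]
  congr 1
  · rw [← ENNReal.ofReal_mul (by positivity)]
    congr 1
    field_simp
    ring
  · refine Finset.sum_congr rfl fun j _ => ?_
    rw [← ENNReal.ofReal_mul (by positivity)]
    congr 1
    field_simp

/-! ### `W(p,1,1) = ζ(p+2) + ζ(p+1,1)` -/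

/-- **`W(p,1,1) = ζ(p+2) + W(0,1,p+1)`** in `ℝ≥0∞`: by the inner telescoping,
`∑_{m,n} 1/(m^p n (m+n)) = ∑_m H_m / m^{p+1}`, and splitting `H_m = 1/m + ∑_{j<m} 1/j` gives
`ζ(p+2)` plus the triangle `∑_{m > j} 1/(j m^{p+1}) = W(0,1,p+1)` (`= ζ(p+1,1)`).
(Borwein–Bradley 2006, §2, with a general exponent.) [cite: BorweinBradley2006, §2] -/
theorem tsum_tornheim_one_one (p : ℕ) :
    ∑' q : ℕ × ℕ, ENNReal.ofReal
        (1 / (((q.1 : ℝ) + 1) ^ p * ((q.2 : ℝ) + 1) ^ 1 * ((q.1 : ℝ) + q.2 + 2) ^ 1)) =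
      (∑' n : ℕ, ENNReal.ofReal (1 / ((n : ℝ) + 1) ^ (p + 2))) +
        ∑' q : ℕ × ℕ, ENNReal.ofReal
          (1 / (((q.1 : ℝ) + 1) ^ 0 * ((q.2 : ℝ) + 1) ^ 1 * ((q.1 : ℝ) + q.2 + 2) ^ (p + 1))) := by
  have hterm : ∀ q : ℕ × ℕ, ENNReal.ofReal
      (1 / (((q.1 : ℝ) + 1) ^ p * ((q.2 : ℝ) + 1) ^ 1 * ((q.1 : ℝ) + q.2 + 2) ^ 1)) =
      ENNReal.ofReal (1 / (((q.1 : ℝ) + 1) ^ p * ((q.2 : ℝ) + 1) * ((q.2 : ℝ) + q.1 + 2))) := by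
    intro q
    rw [pow_one, pow_one, add_comm (q.1 : ℝ) q.2]
  simp_rw [hterm]
  rw [ENNReal.tsum_prod']
  simp_rw [tsum_inner_telescope p]
  rw [ENNReal.tsum_add, ennreal_tsum_sum_range_eq_tsum_prod]
  congr 1
  rw [← (Equiv.prodComm ℕ ℕ).tsum_eq]
  refine tsum_congr fun q => ?_
  simp only [Equiv.prodComm_apply, Prod.fst_swap, Prod.snd_swap]
  rw [pow_zero, one_mul, pow_one]
  congr 1
  push_cast
  ring

/-! ### Unrolling `W(q,1,c)` -/

/-- **`W(q,1,c) = W(0,1,c+q) + ∑_{i<q} ζ(c+1+i, q-i)`** for `c ≥ 1`: the reduction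
`W(a+1,1,c) = W(a,1,c+1) + W(a+1,0,c+1) = W(a,1,c+1) + ζ(c+1,a+1)` iterated
(`tsum_tornheim_succ_succ`, `tsum_tornheim_zero_right`). [folklore] -/
theorem tsum_tornheim_one_unroll : ∀ (q c : ℕ), 1 ≤ c →
    ∑' r : ℕ × ℕ, ENNReal.ofReal
        (1 / (((r.1 : ℝ) + 1) ^ q * ((r.2 : ℝ) + 1) ^ 1 * ((r.1 : ℝ) + r.2 + 2) ^ c)) =
      (∑' r : ℕ × ℕ, ENNReal.ofReal
        (1 / (((r.1 : ℝ) + 1) ^ 0 * ((r.2 : ℝ) + 1) ^ 1 * ((r.1 : ℝ) + r.2 + 2) ^ (c + q)))) +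
        ∑ i ∈ Finset.range q, ENNReal.ofReal (multipleZeta [c + 1 + i, q - i])
  | 0, c, _ => by simp
  | q + 1, c, hc => by
    rw [tsum_tornheim_succ_succ q 0 c, tsum_tornheim_zero_right (by omega) (by omega),
      tsum_tornheim_one_unroll q (c + 1) (by omega), Finset.sum_range_succ', add_assoc,
      show c + 1 + q = c + (q + 1) by ring, Nat.add_zero, Nat.sub_zero]
    congr 2
    exact Finset.sum_congr rfl fun i _ => by
      rw [show c + 1 + 1 + i = c + 1 + (i + 1) by ring, show q - i = q + 1 - (i + 1) by omega]

/-! ### The sum formula -/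

/-- **Euler's sum formula in depth two**, in `ℝ≥0∞`: `∑_{i < n-2} ζ(i+2, n-2-i) = ζ(n)` for
`n ≥ 3`, i.e. `ζ(n-1,1) + ζ(n-2,2) + ⋯ + ζ(2,n-2) = ζ(n)`. [cite: Hoffman1992, §3 p. 281] -/
theorem ofReal_multipleZeta_sum_formula_depth_two {n : ℕ} (hn : 3 ≤ n) :
    ∑ i ∈ Finset.range (n - 2), ENNReal.ofReal (multipleZeta [i + 2, n - 2 - i]) =
      ENNReal.ofReal (multipleZeta [n]) := by
  obtain ⟨p, rfl⟩ : ∃ p, n = p + 3 := ⟨n - 3, by omega⟩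
  simp only [show p + 3 - 2 = p + 1 by omega]
  -- `W(p+1,1,1)` computed in the two ways
  have h1 := tsum_tornheim_one_unroll (p + 1) 1 le_rfl
  have h2 := tsum_tornheim_one_one (p + 1)
  rw [h1] at h2
  -- the finite quantity `W(0,1,p+2) = ζ(p+2,1)`
  have hW : ∑' r : ℕ × ℕ, ENNReal.ofReal
      (1 / (((r.1 : ℝ) + 1) ^ 0 * ((r.2 : ℝ) + 1) ^ 1 * ((r.1 : ℝ) + r.2 + 2) ^ (1 + (p + 1)))) =
      ENNReal.ofReal (multipleZeta [p + 2, 1]) := by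
    rw [show 1 + (p + 1) = p + 2 by ring]
    exact tsum_tornheim_zero_left (by omega) le_rfl
  have hW' : ∑' r : ℕ × ℕ, ENNReal.ofReal
      (1 / (((r.1 : ℝ) + 1) ^ 0 * ((r.2 : ℝ) + 1) ^ 1 * ((r.1 : ℝ) + r.2 + 2) ^ (p + 1 + 1))) =
      ENNReal.ofReal (multipleZeta [p + 2, 1]) := by
    rw [show p + 1 + 1 = p + 2 by ring]
    exact tsum_tornheim_zero_left (by omega) le_rfl
  rw [hW, hW', ← ofReal_multipleZeta_depth_one (a := p + 1 + 2) (by omega), add_comm] at h2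
  -- cancel `ζ(p+2,1)`
  have hfin : ENNReal.ofReal (multipleZeta [p + 2, 1]) ≠ ⊤ := ENNReal.ofReal_ne_top
  have h3 := (ENNReal.add_left_inj hfin).mp h2
  rw [show p + 1 + 2 = p + 3 by ring] at h3
  refine Eq.trans (Finset.sum_congr rfl fun i hi => ?_) h3
  have hi' := Finset.mem_range.1 hi
  rw [show 1 + 1 + i = i + 2 by ring]

/-- **Euler's sum formula in depth two** (Euler 1775; Hoffman 1992, §3 p. 281: "in the case
`k = 2` it says that `A(n-1,1) + A(n-2,2) + ⋯ + A(1,n-2)`[sic, `A(2,n-2)`]` = ζ(n)` … This was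
proved in Euler's paper"; Chmutov–Duzhin–Mostovoy 2012, (10.15)): for every `n ≥ 3`,
`∑_{i < n-2} ζ(i+2, n-2-i) = ζ(n-1,1)` `+ ⋯ + ζ(2,n-2)` ` = ζ(n)` — written with
`i + 2 = a` running over `2, …, n-1` and second argument `n - a`.
[cite: Hoffman1992, §3 p. 281 (sum conjecture, k = 2)] -/
theorem multipleZeta_sum_formula_depth_two {n : ℕ} (hn : 3 ≤ n) :
    ∑ i ∈ Finset.range (n - 2), multipleZeta [i + 2, n - 2 - i] = multipleZeta [n] := by
  have hnn : ∀ i ∈ Finset.range (n - 2), 0 ≤ multipleZeta [i + 2, n - 2 - i] := fun i hi =>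
    (multipleZeta_pos_of_isAdmissible_holds (MZV.isAdmissible_pair (by omega)
      (by have := Finset.mem_range.1 hi; omega))).le
  have h := ofReal_multipleZeta_sum_formula_depth_two hn
  rw [← ENNReal.ofReal_sum_of_nonneg hnn, ENNReal.ofReal_eq_ofReal_iff (Finset.sum_nonneg hnn)
    (multipleZeta_pos_of_isAdmissible_holds (MZV.isAdmissible_singleton_of_two_le (by omega))).le] at h
  exact h

/-- Instance `n = 3`: Euler's `ζ(2,1) = ζ(3)` once more. [cite: Hoffman1992, §3 p. 281] -/
example : multipleZeta [2, 1] = multipleZeta [3] := by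
  simpa using multipleZeta_sum_formula_depth_two (n := 3) le_rfl

/-- Instance `n = 6`: `ζ(2,4) + ζ(3,3) + ζ(4,2) + ζ(5,1) = ζ(6)`. [cite: Hoffman1992, §3 p. 281] -/
theorem multipleZeta_sum_formula_weight_six :
    multipleZeta [2, 4] + multipleZeta [3, 3] + multipleZeta [4, 2] + multipleZeta [5, 1] =
      multipleZeta [6] := by
  have h := multipleZeta_sum_formula_depth_two (n := 6) (by norm_num)
  simp only [show (6 : ℕ) - 2 = 4 from rfl, Finset.sum_range_succ, Finset.sum_range_zero,
    zero_add] at h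
  exact h

end Literature.NumberTheory.Transcendental
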